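import Mathlib
import Summits.ValiantsHypothesis.ValiantsHypothesis.Theorems.LacunarySymmetroidMatrixDescartesCensusChamberReduction
import Summits.ValiantsHypothesis.ValiantsHypothesis.Theorems.LacunarySymmetroidMatrixDescartesDoorA26WallBubblingConeTransfer

/-!
# Wall bubbling for `DoorA26` — STAR ROWS: twenties do not accumulate at a point all of whose adjacent chambers carry the door-A row

LINE / STUBS.  Crux `Theses.LacunarySymmetroid.DoorA26` (stmt-ValiantsHypothesis-19979; OPEN, typed, never asserted), line
`Cruxes/DoorA26/Lines/wall_bubbling.lean` (obligations (M) `stub_mixedWalls`, (D), (W), (R)).  Completion of the census ↔ line dictionary of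
`…WallBubblingConeTransfer` from GENERIC facet points to ARBITRARY points `δ₀ ∈ ℝ⁶` (any number of pair-sum coincidences):
* `exists_realOrder_of_injOn` — a real exponent vector with pairwise distinct canonical pair sums lies in the open cone of SOME covering order of
  canonical pairs (sort the 21 sums; the real twin of `Census.exists_chamberOrder_of_injOn`);
* `star_nhds` — every `δ₀` has a neighbourhood `U` such that each `δ ∈ U` either has a pair-sum coincidence or lies in the open cone of a covering
  canonical order `σ` which is COMPATIBLE with `δ₀` (`Monotone (pairSum δ₀ ∘ σ)`: `σ` is one of the chambers in the STAR of `δ₀`);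
* `not_mem_closure_twentyLocus_of_star_rows` — **STAR ROWS RETIRE A POINT**: if every covering canonical order compatible with `δ₀` carries the
  integer door-A row (`∀ d, StrictMono (pairSum d ∘ σ) → PosRootLawOn 2 6 19 d` — the landed `Census.doorA26_on_chamber<n>` rows, one per chamber of
  the star), then `δ₀ ∉ closure TwentyLocus` (the line's literal set): (M), (D) — indeed every accumulation statement — hold at `δ₀` FOR FREE.
  So the (M)/(W)-specific analysis (the line's sieve, W1's parity law) is needed exactly at points whose star contains an UNCERTIFIED chamber; at
  1 242 rows, 1 132 of the 4 640 mixed facets already have a fully certified star (both sides), and the 18 facets of the hard core have none.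
HONEST FRAMING.  Cell `pub-symmetroid`, seat val-sym-door-p2 g11 (re-pointed W1, R2664), `--supports stmt-ValiantsHypothesis-19979 --as helper`.  Finite
combinatorics + the cone transfer; no new definitions; (M), (W), (R) and `DoorA26` stay OPEN; registers unchanged; nothing on `MatrixDescartes`
(stmt-ValiantsHypothesis-18050) or `VP ≠ VNP`. [this work]
-/

-- `Summit.ValiantsHypothesis.ValiantsHypothesis.…` repeats a component by the D-0017 layout
-- (single-conjunct summit), which the `dupNamespace` linter flags; the name is mandated.
set_option linter.dupNamespace false

namespace Summit.ValiantsHypothesis.ValiantsHypothesis.Theorems.LacunarySymmetroidMatrixDescartes.WallBubbling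

open Finset Filter Topology
open scoped BigOperators
open Summit.ValiantsHypothesis.ValiantsHypothesis.Theorems.LacunarySymmetroidMatrixDescartes (PosRootLawOn)
open Summit.ValiantsHypothesis.ValiantsHypothesis.Theorems.LacunarySymmetroidMatrixDescartes.Census (card_canonicalPairs)

/-! ## §1 Sorting real pair sums -/

/-- **Every real exponent vector with distinct canonical pair sums lies in the open cone of a covering canonical order** (sort the 21 sums).
[folklore] -/
theorem exists_realOrder_of_injOn (δ : Fin 6 → ℝ)
    (hinj : Set.InjOn (fun p : Fin 6 × Fin 6 => δ p.1 + δ p.2) ↑((univ : Finset (Fin 6 × Fin 6)).filter (fun p => p.1 ≤ p.2))) :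
    ∃ σ : Fin 21 → Fin 6 × Fin 6, (∀ t, (σ t).1 ≤ (σ t).2) ∧ (∀ p : Fin 6 × Fin 6, ∃ t : Fin 21, σ t = p ∨ σ t = p.swap) ∧
      StrictMono ((fun p : Fin 6 × Fin 6 => δ p.1 + δ p.2) ∘ σ) := by
  classical
  set T := (univ : Finset (Fin 6 × Fin 6)).filter (fun p => p.1 ≤ p.2) with hT
  set f : Fin 6 × Fin 6 → ℝ := fun p => δ p.1 + δ p.2 with hf
  set W := T.image f with hW
  have hWcard : W.card = 21 := by rw [hW, card_image_of_injOn hinj, hT]; exact card_canonicalPairs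
  set emb := W.orderEmbOfFin hWcard with hemb
  have hmem : ∀ t : Fin 21, emb t ∈ W := fun t => Finset.orderEmbOfFin_mem W hWcard t
  have hex : ∀ t : Fin 21, ∃ p : Fin 6 × Fin 6, p ∈ T ∧ f p = emb t := by
    intro t
    obtain ⟨p, hp, hpe⟩ := mem_image.mp (hmem t)
    exact ⟨p, hp, hpe⟩
  choose σ hσT hσf using hex
  refine ⟨σ, fun t => (mem_filter.mp (hσT t)).2, ?_, ?_⟩
  · intro p
    have key : ∀ c : Fin 6 × Fin 6, c ∈ T → ∃ t : Fin 21, σ t = c := by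
      intro c hc
      have hcW : f c ∈ (W : Set ℝ) := by
        rw [Finset.mem_coe]; exact mem_image.mpr ⟨c, hc, rfl⟩
      rw [← Finset.range_orderEmbOfFin W hWcard, Set.mem_range] at hcW
      obtain ⟨t, ht⟩ := hcW
      refine ⟨t, hinj (hσT t) hc ?_⟩
      show f (σ t) = f c
      rw [hσf t]; exact ht
    rcases le_total p.1 p.2 with h | h
    · obtain ⟨t, ht⟩ := key p (mem_filter.mpr ⟨mem_univ _, h⟩)
      exact ⟨t, Or.inl ht⟩
    · obtain ⟨t, ht⟩ := key p.swap (mem_filter.mpr ⟨mem_univ _, by simpa using h⟩)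
      exact ⟨t, Or.inr ht⟩
  · intro s t hst
    show f (σ s) < f (σ t)
    rw [hσf s, hσf t]
    exact (W.orderEmbOfFin hWcard).strictMono hst

/-! ## §2 The star neighbourhood -/

/-- **Star neighbourhood.**  Every `δ₀` has a neighbourhood in which each `δ` either has a coincidence of two distinct canonical pair sums, or lies
in the open cone of a covering canonical order `σ` compatible with `δ₀` (`pairSum δ₀ ∘ σ` monotone). [this work] -/
theorem star_nhds (δ₀ : Fin 6 → ℝ) :
    ∃ U ∈ 𝓝 δ₀, ∀ δ ∈ U,
      (∃ i j k l : Fin 6, i ≤ j ∧ k ≤ l ∧ (i, j) ≠ (k, l) ∧ δ i + δ j = δ k + δ l) ∨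
      (∃ σ : Fin 21 → Fin 6 × Fin 6, (∀ t, (σ t).1 ≤ (σ t).2) ∧ (∀ p : Fin 6 × Fin 6, ∃ t : Fin 21, σ t = p ∨ σ t = p.swap) ∧
        StrictMono ((fun p : Fin 6 × Fin 6 => δ p.1 + δ p.2) ∘ σ) ∧ Monotone ((fun p : Fin 6 × Fin 6 => δ₀ p.1 + δ₀ p.2) ∘ σ)) := by
  classical
  let a : (Fin 6 → ℝ) → Fin 6 × Fin 6 → ℝ := fun δ p => δ p.1 + δ p.2
  have ha_cont : ∀ p, Continuous fun δ : Fin 6 → ℝ => a δ p := fun p => by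
    show Continuous fun δ : Fin 6 → ℝ => δ p.1 + δ p.2
    fun_prop
  let good : (Fin 6 × Fin 6) → (Fin 6 × Fin 6) → Prop := fun p q => a δ₀ p < a δ₀ q
  let U : Set (Fin 6 → ℝ) := ⋂ p : Fin 6 × Fin 6, ⋂ q : Fin 6 × Fin 6, {δ | good p q → a δ p < a δ q}
  have hUopen : IsOpen U := by
    refine isOpen_iInter_of_finite fun p => isOpen_iInter_of_finite fun q => ?_
    by_cases hg : good p q
    · have : {δ : Fin 6 → ℝ | good p q → a δ p < a δ q} = {δ | a δ p < a δ q} := by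
        ext δ; simp [hg]
      rw [this]; exact isOpen_lt (ha_cont p) (ha_cont q)
    · have : {δ : Fin 6 → ℝ | good p q → a δ p < a δ q} = Set.univ := by
        ext δ; simp [hg]
      rw [this]; exact isOpen_univ
  have hU0 : δ₀ ∈ U := by
    simp only [U, Set.mem_iInter, Set.mem_setOf_eq]
    intro p q hg; exact hg
  refine ⟨U, hUopen.mem_nhds hU0, fun δ hδ => ?_⟩
  simp only [U, Set.mem_iInter, Set.mem_setOf_eq] at hδ
  by_cases hinj : Set.InjOn (fun p : Fin 6 × Fin 6 => δ p.1 + δ p.2) ↑((univ : Finset (Fin 6 × Fin 6)).filter (fun p => p.1 ≤ p.2))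
  · obtain ⟨σ, hcan, hcov, hmono⟩ := exists_realOrder_of_injOn δ hinj
    refine Or.inr ⟨σ, hcan, hcov, hmono, ?_⟩
    intro s t hst
    rcases eq_or_lt_of_le hst with h | h
    · subst h; exact le_rfl
    · by_contra hcon
      have hlt : a δ₀ (σ t) < a δ₀ (σ s) := not_le.mp hcon
      have h1 : a δ (σ t) < a δ (σ s) := hδ _ _ hlt
      have h2 : a δ (σ s) < a δ (σ t) := hmono h
      exact lt_asymm h1 h2
  · left
    rw [Set.InjOn] at hinj
    push Not at hinj
    obtain ⟨p, hp, q, hq, hpq, hne⟩ := hinj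
    rw [Finset.mem_coe, mem_filter] at hp hq
    refine ⟨p.1, p.2, q.1, q.2, hp.2, hq.2, ?_, hpq⟩
    intro h; exact hne (Prod.ext (Prod.mk.inj h).1 (Prod.mk.inj h).2)

/-! ## §3 Star rows retire a point -/

/-- **STAR ROWS RETIRE A POINT.**  If every covering canonical order `σ` compatible with `δ₀` (a chamber of the STAR of `δ₀`) carries the integer
door-A row, then `δ₀` is not in the closure of the twenty-locus: no accumulation of twenties at `δ₀` of any kind. [this work] -/
theorem not_mem_closure_twentyLocus_of_star_rows (δ₀ : Fin 6 → ℝ)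
    (hrows : ∀ σ : Fin 21 → Fin 6 × Fin 6, (∀ t, (σ t).1 ≤ (σ t).2) → (∀ p : Fin 6 × Fin 6, ∃ t : Fin 21, σ t = p ∨ σ t = p.swap) →
      Monotone ((fun p : Fin 6 × Fin 6 => δ₀ p.1 + δ₀ p.2) ∘ σ) →
      ∀ d : Fin 6 → ℕ, StrictMono ((fun p : Fin 6 × Fin 6 => d p.1 + d p.2) ∘ σ) → PosRootLawOn 2 6 19 d) :
    δ₀ ∉ closure {δ : Fin 6 → ℝ | ∃ S : Fin 6 → Matrix (Fin 2) (Fin 2) ℝ, (∀ l, (S l).IsSymm) ∧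
      20 ≤ {x : ℝ | 0 < x ∧ (∑ l, (x ^ (δ l)) • S l).det = 0}.ncard} := by
  obtain ⟨U, hU, hcov⟩ := star_nhds δ₀
  intro hcl
  rw [mem_closure_iff_nhds] at hcl
  obtain ⟨δ, hδU, S, hS, h20⟩ := hcl U hU
  rcases hcov δ hδU with ⟨i, j, k, l, hij, hkl, hne, hsum⟩ | ⟨σ, hcan, hcovσ, hmono, hcompat⟩
  · have h := Census.RealExp.realRow_two_six_of_pairSum_eq δ hij hkl hne hsum S
    omega
  · have h := realCone_row_of_natRow σ (hrows σ hcan hcovσ hcompat) δ hmono S hS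
    omega

end Summit.ValiantsHypothesis.ValiantsHypothesis.Theorems.LacunarySymmetroidMatrixDescartes.WallBubbling
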